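/-
Copyright (c) 2026 the pub-hodgecm-mathlib formalisation cell (harness21).  Prover seat hodgecm-mathlib-K2E5-p17 (g8), Track B «K2-LIT»,
#184♮ = hLiu418 = `stmt-HodgeConjecture-24832`; ROAD Φ, G5-b = Φ7-3, spare S-d (K2E5-plan (g7) TABLE #2 2026-09-04T14:58:26Z): the growth binder `hWg` of ★ p861061
`exists_rankOne_package_cleared` ∕ ★ (γ′) p860939 from Levi-height comparison data.  THEOREMS ONLY (no `def`, no `instance`, no named-fact hypothesis, no `sorry`).
-/
import Summits.HodgeConjecture.HodgeConjecture.Theorems.K2LiuRankOneInnerWhittakerContinued   -- ★ (R1-γ) `growth_halfShift_mul_add{_cleared}` (this seat) ⊇ ★ (γ′)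
import HarnessLib

/-!
# Crux `HLiu418`, ROAD Φ, organ Φ7-3, spare S-d: THE GROWTH LETTER OF THE RANK-ONE TERM PACKAGE FROM A LEVI-HEIGHT COMPARISON —
# `‖ρ(s)·V_j(ℓ(s), y_j(x))‖ ≤ C·height(x)^A` locally uniformly, hence `hWg`

Cell `hodgecm-mathlib`, crux item hLiu418 = `stmt-HodgeConjecture-24832` (helper lane `--supports … --as helper`, count-neutral).

★ (R1-γ) `K2LiuRankOneInnerWhittakerContinued.growth_halfShift_mul_add_cleared` already reduces the growth binder `hWg` of ★ `exists_rankOne_package_cleared` (and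
`growth_halfShift_mul_add` that of ★ (γ′) `exists_rankOne_package`) to TWO MONOMIAL LETTERS, `‖Wb j s x‖ ≤ C·height x^A` and `‖Wa⋆ j s x‖ ≤ C·height x^A` locally uniformly in `s`
near each `z` (`0 < re z`), uniformly in `j, x`, plus a height floor.  The unfolding (R1-α) delivers each inner value in the shape SCALAR × INNER VALUE AT A LEVI TRANSLATE:
`Wb j s x = ρ_b(s)·Vb_j(s + ½, yb_j(x))`, `Wa⋆ j s x = G(s)·Va_j(ℓ(s), ya_j(x))` — the inner-line (`n = 1`) Whittaker value of the `j`-th Godement constituent at the inner parameter, read at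
a Levi coordinate `y_j(x) ∈ Y` (at `X = H(𝔸)`: `Y = GL₂(𝔸_L)` or the inner line's group, `y_j(x) = m(p′_S)·x`-type Iwasawa coordinates).  THIS FILE is the COMPOSITION that turns
 (i) continuity of the scalars on `{0 < re}` (★ O41.6-type cleared scalars are holomorphic there),
 (ii) the INNER GROWTH `‖V_j(s′, y)‖ ≤ C·hgtY(y)^A` locally uniformly near the inner parameter `ℓ(z)`, uniformly in `j, y` (the `n := 1` Whittaker growth — ★ O41.3-type majorant ∕ ★ G7
      `K2LiuIwasawaHeightLatticeSumBound` road; BY VALUE here), and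
 (iii) the LEVI-HEIGHT COMPARISON `hgtY(y_j(x)) ≤ C₀·height(x)^{A₀}` (★ `K2LiuSiegelHeightComparisonGLn` ∕ ★ `K2LiuArchBlockHeightBound`-type; BY VALUE here — the pattern of ★ G5-a
      `K2LiuSiegelEisensteinRankZeroTermPackage.exists_middle_package`'s binders `(g) (hg) (hEg)`)
into those monomial letters and hence into `hWg` — token for token the binders of ★ p861061 ∕ ★ p860939.
* §1 `exists_ball_norm_le_of_continuousOn` (a function continuous on `{0 < re}` is bounded near each of its points, inside the half-plane), `rpow_comparison_le`
  (`t ≤ C₀ h^{A₀}` ⇒ `t^A ≤ C₀^A h^{A₀A}` for `A ≥ 0`).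
* §2 **`growth_scalar_mul_comp`** — the monomial letter for `ρ(s)·V_j(ℓ(s), y_j(x))`.
* §3 **`hWg_cleared_of_comparison`** (★ p861061's binder) and **`hWg_of_comparison`** (★ (γ′)'s binder, residue-free currency `Wa = ρ_a·Ea`, `G = (s − ½)ρ_a` off `½`).
Sources: [MoeglinWaldspurger1995, II.1.7, IV.1.9 (moderate growth of Eisenstein series and of their constant terms ∕ coefficients, locally uniform in the parameter)];
[KudlaRallis1994, §2]; [Tan1999, §4 Prop. 4.8]; [Shimura1997, §18.3].
HONEST LABEL.  Count-neutral helper; `HC_CM` is proved only modulo the 7 printed citations (2 remaining named inputs: hLiu418 = `stmt-HodgeConjecture-24832`,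
h413 = `stmt-HodgeConjecture-24833`) until rung 0 closes.
-/

set_option autoImplicit false
set_option linter.dupNamespace false -- the mandated namespace repeats `HodgeConjecture.HodgeConjecture`

noncomputable section

namespace Summit.HodgeConjecture.HodgeConjecture.Cruxes.HLiu418.K2LiuRankOneTermGrowthComparison

open Set Filter Topology Metric Complex
open scoped BigOperators
open K2LiuRankOneInnerWhittakerContinued

/-! ## §1 Devices -/

section Devices

/-- **a function continuous on `{0 < re}` is bounded near each point of the half-plane, by a ball INSIDE the half-plane**: `∃ M r, 0 ≤ M ∧ 0 < r ∧ r ≤ re z ∧ ∀ s, dist s z < r → ‖ρ s‖ ≤ M`.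
[folklore] -/
theorem exists_ball_norm_le_of_continuousOn {ρ : ℂ → ℂ} (hρ : ContinuousOn ρ {s : ℂ | 0 < s.re}) {z : ℂ} (hz : 0 < z.re) :
    ∃ M r : ℝ, 0 ≤ M ∧ 0 < r ∧ r ≤ z.re ∧ ∀ s : ℂ, dist s z < r → ‖ρ s‖ ≤ M := by
  have hc : ContinuousAt ρ z := hρ.continuousAt ((isOpen_lt continuous_const Complex.continuous_re).mem_nhds hz)
  obtain ⟨δ, hδ, h⟩ := Metric.continuousAt_iff.1 hc 1 one_pos
  refine ⟨‖ρ z‖ + 1, min δ z.re, by positivity, lt_min hδ hz, min_le_right _ _, fun s hs => ?_⟩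
  have h1 : dist (ρ s) (ρ z) < 1 := h (lt_of_lt_of_le hs (min_le_left _ _))
  rw [dist_eq_norm] at h1
  calc ‖ρ s‖ = ‖(ρ s - ρ z) + ρ z‖ := by rw [sub_add_cancel]
    _ ≤ ‖ρ s - ρ z‖ + ‖ρ z‖ := norm_add_le _ _
    _ ≤ ‖ρ z‖ + 1 := by linarith

/-- inside such a ball the real part stays positive. [folklore] -/
theorem re_pos_of_dist_lt {z s : ℂ} {r : ℝ} (hr : r ≤ z.re) (hs : dist s z < r) : 0 < s.re := by
  have h1 : |s.re - z.re| ≤ dist s z := by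
    rw [dist_eq_norm]; simpa using abs_re_le_norm (s - z)
  have h2 := (abs_lt.1 (lt_of_le_of_lt h1 (lt_of_lt_of_le hs hr))).1
  linarith

/-- **the monotone step of the comparison**: `0 ≤ t ≤ C₀·h^{A₀}` with `h ≥ 0`, `C₀ ≥ 0`, `A ≥ 0` ⇒ `t^A ≤ C₀^A·h^{A₀·A}`. [folklore] -/
theorem rpow_comparison_le {t h C₀ A₀ A : ℝ} (ht : 0 ≤ t) (hh : 0 ≤ h) (hC₀ : 0 ≤ C₀) (hA : 0 ≤ A) (hle : t ≤ C₀ * h ^ A₀) :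
    t ^ A ≤ C₀ ^ A * h ^ (A₀ * A) := by
  calc t ^ A ≤ (C₀ * h ^ A₀) ^ A := Real.rpow_le_rpow ht hle hA
    _ = C₀ ^ A * (h ^ A₀) ^ A := Real.mul_rpow hC₀ (Real.rpow_nonneg hh _)
    _ = C₀ ^ A * h ^ (A₀ * A) := by rw [← Real.rpow_mul hh]

end Devices

/-! ## §2 The monomial letter for `ρ(s)·V_j(ℓ(s), y_j(x))` -/

section Comp

variable {X Y : Type*} {ι : Type*}

/-- **GROWTH OF SCALAR × INNER VALUE AT A LEVI TRANSLATE.**  DATA (by value): a height `height : X → ℝ_{>0}`; a Levi height `hgtY : Y → ℝ_{≥0}`; Levi coordinates `y j : X → Y` with the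
COMPARISON `hgtY (y j x) ≤ C₀·height x^{A₀}` (`0 ≤ C₀, A₀`); a continuous parameter map `ℓ : ℂ → ℂ` (`s + ½`, `−s − ½`); inner values `V j : ℂ → Y → ℂ` with INNER GROWTH near every
inner parameter `ℓ z`, `0 < re z`: `‖V j s′ yy‖ ≤ C·hgtY yy^A` for `dist s′ (ℓ z) < r`, uniformly in `j, yy` (`0 ≤ C, A`); a scalar `ρ` continuous on `{0 < re}`.  THEN
`‖ρ(s)·V_j(ℓ(s), y_j(x))‖ ≤ C′·height(x)^{A′}` for `dist s z < r′`, uniformly in `j, x` — the monomial letters `hbg`∕`hag` of ★ `growth_halfShift_mul_add_cleared`.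
[cite: MoeglinWaldspurger1995, II.1.7, IV.1.9] [cite: Tan1999, §4 Prop. 4.8] -/
theorem growth_scalar_mul_comp (height : X → ℝ) (hpos : ∀ x, 0 < height x) (hgtY : Y → ℝ) (hY : ∀ yy, 0 ≤ hgtY yy)
    (y : ι → X → Y) {C₀ A₀ : ℝ} (hC₀ : 0 ≤ C₀) (hA₀ : 0 ≤ A₀) (hy : ∀ j x, hgtY (y j x) ≤ C₀ * height x ^ A₀)
    (ℓ : ℂ → ℂ) (hℓ : Continuous ℓ) (V : ι → ℂ → Y → ℂ)
    (hV : ∀ z : ℂ, 0 < z.re → ∃ C A r : ℝ, 0 ≤ C ∧ 0 ≤ A ∧ 0 < r ∧ ∀ s' : ℂ, dist s' (ℓ z) < r → ∀ j yy, ‖V j s' yy‖ ≤ C * hgtY yy ^ A)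
    (ρ : ℂ → ℂ) (hρ : ContinuousOn ρ {s : ℂ | 0 < s.re}) :
    ∀ z : ℂ, 0 < z.re → ∃ C A r : ℝ, 0 ≤ C ∧ 0 ≤ A ∧ 0 < r ∧ ∀ s : ℂ, dist s z < r →
      ∀ j x, ‖ρ s * V j (ℓ s) (y j x)‖ ≤ C * height x ^ A := by
  intro z hz
  obtain ⟨M, r₁, hM, hr₁, -, hρle⟩ := exists_ball_norm_le_of_continuousOn hρ hz
  obtain ⟨C, A, r₂, hC, hA, hr₂, hVle⟩ := hV z hz
  -- continuity of `ℓ` at `z`: `dist s z < r₃ ⇒ dist (ℓ s) (ℓ z) < r₂`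
  obtain ⟨r₃, hr₃, hℓle⟩ := Metric.continuousAt_iff.1 hℓ.continuousAt r₂ hr₂
  refine ⟨M * (C * C₀ ^ A), A₀ * A, min r₁ r₃, by positivity, mul_nonneg hA₀ hA, lt_min hr₁ hr₃, fun s hs j x => ?_⟩
  have hs₁ : dist s z < r₁ := lt_of_lt_of_le hs (min_le_left _ _)
  have hs₃ : dist s z < r₃ := lt_of_lt_of_le hs (min_le_right _ _)
  have hx := hpos x
  have h1 : ‖V j (ℓ s) (y j x)‖ ≤ C * hgtY (y j x) ^ A := hVle (ℓ s) (hℓle hs₃) j (y j x)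
  have h2 : hgtY (y j x) ^ A ≤ C₀ ^ A * height x ^ (A₀ * A) := rpow_comparison_le (hY _) hx.le hC₀ hA (hy j x)
  calc ‖ρ s * V j (ℓ s) (y j x)‖ = ‖ρ s‖ * ‖V j (ℓ s) (y j x)‖ := norm_mul _ _
    _ ≤ M * (C * (C₀ ^ A * height x ^ (A₀ * A))) :=
        mul_le_mul (hρle s hs₁) (h1.trans (mul_le_mul_of_nonneg_left h2 hC)) (norm_nonneg _) hM
    _ = M * (C * C₀ ^ A) * height x ^ (A₀ * A) := by ring

/-- the same for a scalar HOLOMORPHIC on `{0 < re}` (★ O41.6's cleared scalars, `ρ_b`). [cite: MoeglinWaldspurger1995, IV.1.9] -/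
theorem growth_scalar_mul_comp_of_differentiableOn (height : X → ℝ) (hpos : ∀ x, 0 < height x) (hgtY : Y → ℝ) (hY : ∀ yy, 0 ≤ hgtY yy)
    (y : ι → X → Y) {C₀ A₀ : ℝ} (hC₀ : 0 ≤ C₀) (hA₀ : 0 ≤ A₀) (hy : ∀ j x, hgtY (y j x) ≤ C₀ * height x ^ A₀)
    (ℓ : ℂ → ℂ) (hℓ : Continuous ℓ) (V : ι → ℂ → Y → ℂ)
    (hV : ∀ z : ℂ, 0 < z.re → ∃ C A r : ℝ, 0 ≤ C ∧ 0 ≤ A ∧ 0 < r ∧ ∀ s' : ℂ, dist s' (ℓ z) < r → ∀ j yy, ‖V j s' yy‖ ≤ C * hgtY yy ^ A)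
    (ρ : ℂ → ℂ) (hρ : DifferentiableOn ℂ ρ {s : ℂ | 0 < s.re}) :
    ∀ z : ℂ, 0 < z.re → ∃ C A r : ℝ, 0 ≤ C ∧ 0 ≤ A ∧ 0 < r ∧ ∀ s : ℂ, dist s z < r →
      ∀ j x, ‖ρ s * V j (ℓ s) (y j x)‖ ≤ C * height x ^ A :=
  growth_scalar_mul_comp height hpos hgtY hY y hC₀ hA₀ hy ℓ hℓ V hV ρ hρ.continuousOn

/-- the two parameter maps of Φ7-3 are continuous: `s ↦ s + ½` (term (b)) and `s ↦ −s − ½` (term (a), census (F2)). [cite: KudlaRallis1994, §2] -/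
theorem continuous_shift_half : Continuous (fun s : ℂ => s + 1 / 2) ∧ Continuous (fun s : ℂ => -s - 1 / 2) :=
  ⟨continuous_id.add continuous_const, continuous_id.neg.sub continuous_const⟩

end Comp

/-! ## §3 The growth binders of ★ p861061 and ★ (γ′) -/

section Letters

variable {X Y : Type*} {ι : Type*}

/-- **THE `hWg` BINDER OF ★ `exists_rankOne_package_cleared` FROM COMPARISON DATA.**  With `Wb j s x := ρ_b(s)·Vb_j(ℓb s, yb_j x)` and `WaStar j s x := G(s)·Va_j(ℓa s, ya_j x)`
(scalars continuous on `{0 < re}`, inner growths and Levi comparisons as in `growth_scalar_mul_comp`, a height floor `m ≤ height`):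
`∀ z, 0 < re z → ∃ C A r, 0 ≤ C ∧ 0 ≤ A ∧ 0 < r ∧ ∀ s, dist s z < r → ∀ j x, ‖(s − ½)·Wb j s x + WaStar j s x‖ ≤ C·height x^A` — ★ p861061's binder, token for token.
[cite: MoeglinWaldspurger1995, II.1.7, IV.1.9] [cite: Tan1999, §4 Prop. 4.8] [cite: Shimura1997, §18.3] -/
theorem hWg_cleared_of_comparison (height : X → ℝ) (hpos : ∀ x, 0 < height x) {m : ℝ} (hm : 0 < m) (hfloor : ∀ x, m ≤ height x)
    (hgtY : Y → ℝ) (hY : ∀ yy, 0 ≤ hgtY yy)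
    (yb ya : ι → X → Y) {C₀ A₀ : ℝ} (hC₀ : 0 ≤ C₀) (hA₀ : 0 ≤ A₀)
    (hyb : ∀ j x, hgtY (yb j x) ≤ C₀ * height x ^ A₀) (hya : ∀ j x, hgtY (ya j x) ≤ C₀ * height x ^ A₀)
    (ℓb ℓa : ℂ → ℂ) (hℓb : Continuous ℓb) (hℓa : Continuous ℓa) (Vb Va : ι → ℂ → Y → ℂ)
    (hVb : ∀ z : ℂ, 0 < z.re → ∃ C A r : ℝ, 0 ≤ C ∧ 0 ≤ A ∧ 0 < r ∧ ∀ s' : ℂ, dist s' (ℓb z) < r → ∀ j yy, ‖Vb j s' yy‖ ≤ C * hgtY yy ^ A)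
    (hVa : ∀ z : ℂ, 0 < z.re → ∃ C A r : ℝ, 0 ≤ C ∧ 0 ≤ A ∧ 0 < r ∧ ∀ s' : ℂ, dist s' (ℓa z) < r → ∀ j yy, ‖Va j s' yy‖ ≤ C * hgtY yy ^ A)
    (ρb G : ℂ → ℂ) (hρb : ContinuousOn ρb {s : ℂ | 0 < s.re}) (hG : ContinuousOn G {s : ℂ | 0 < s.re}) :
    ∀ z : ℂ, 0 < z.re → ∃ C A r : ℝ, 0 ≤ C ∧ 0 ≤ A ∧ 0 < r ∧ ∀ s : ℂ, dist s z < r →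
      ∀ j x, ‖(s - 1 / 2) * (ρb s * Vb j (ℓb s) (yb j x)) + G s * Va j (ℓa s) (ya j x)‖ ≤ C * height x ^ A :=
  growth_halfShift_mul_add_cleared height hm hfloor (fun j s x => ρb s * Vb j (ℓb s) (yb j x)) (fun j s x => G s * Va j (ℓa s) (ya j x))
    (growth_scalar_mul_comp height hpos hgtY hY yb hC₀ hA₀ hyb ℓb hℓb Vb hVb ρb hρb)
    (growth_scalar_mul_comp height hpos hgtY hY ya hC₀ hA₀ hya ℓa hℓa Va hVa G hG)

/-- **THE `hWg` BINDER OF ★ (γ′) `exists_rankOne_package` FROM COMPARISON DATA** (residue-free currency): with the RAW big-cell letter `Wa j s x := ρ_a(s)·Va_j(ℓa s, ya_j x)` and the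
cleared scalar `G = (s − ½)·ρ_a` off `½` (`hGρ`), the binder `‖(s − ½)·(Wb j s x + Wa j s x)‖ ≤ C·height x^A` locally uniformly — token for token.
[cite: MoeglinWaldspurger1995, II.1.7, IV.1.9] [cite: Tan1999, §4 Prop. 4.8] -/
theorem hWg_of_comparison (height : X → ℝ) (hpos : ∀ x, 0 < height x) {m : ℝ} (hm : 0 < m) (hfloor : ∀ x, m ≤ height x)
    (hgtY : Y → ℝ) (hY : ∀ yy, 0 ≤ hgtY yy)
    (yb ya : ι → X → Y) {C₀ A₀ : ℝ} (hC₀ : 0 ≤ C₀) (hA₀ : 0 ≤ A₀)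
    (hyb : ∀ j x, hgtY (yb j x) ≤ C₀ * height x ^ A₀) (hya : ∀ j x, hgtY (ya j x) ≤ C₀ * height x ^ A₀)
    (ℓb ℓa : ℂ → ℂ) (hℓb : Continuous ℓb) (hℓa : Continuous ℓa) (Vb Va : ι → ℂ → Y → ℂ)
    (hVb : ∀ z : ℂ, 0 < z.re → ∃ C A r : ℝ, 0 ≤ C ∧ 0 ≤ A ∧ 0 < r ∧ ∀ s' : ℂ, dist s' (ℓb z) < r → ∀ j yy, ‖Vb j s' yy‖ ≤ C * hgtY yy ^ A)
    (hVa : ∀ z : ℂ, 0 < z.re → ∃ C A r : ℝ, 0 ≤ C ∧ 0 ≤ A ∧ 0 < r ∧ ∀ s' : ℂ, dist s' (ℓa z) < r → ∀ j yy, ‖Va j s' yy‖ ≤ C * hgtY yy ^ A)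
    (ρb ρa G : ℂ → ℂ) (hρb : ContinuousOn ρb {s : ℂ | 0 < s.re}) (hG : ContinuousOn G {s : ℂ | 0 < s.re})
    (hGρ : ∀ s : ℂ, 0 < s.re → s ≠ 1 / 2 → G s = (s - 1 / 2) * ρa s) :
    ∀ z : ℂ, 0 < z.re → ∃ C A r : ℝ, 0 ≤ C ∧ 0 ≤ A ∧ 0 < r ∧ ∀ s : ℂ, dist s z < r →
      ∀ j x, ‖(s - 1 / 2) * (ρb s * Vb j (ℓb s) (yb j x) + ρa s * Va j (ℓa s) (ya j x))‖ ≤ C * height x ^ A :=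
  growth_halfShift_mul_add height hpos hm hfloor (fun j s x => ρb s * Vb j (ℓb s) (yb j x)) ρa G hGρ (fun j s x => Va j (ℓa s) (ya j x))
    (growth_scalar_mul_comp height hpos hgtY hY yb hC₀ hA₀ hyb ℓb hℓb Vb hVb ρb hρb)
    (growth_scalar_mul_comp height hpos hgtY hY ya hC₀ hA₀ hya ℓa hℓa Va hVa G hG)

end Letters

end Summit.HodgeConjecture.HodgeConjecture.Cruxes.HLiu418.K2LiuRankOneTermGrowthComparison

end
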